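import Summits.CriticalPhenomena.PercolationContinuityZ3.Theorems.PercNearOneGluingNoHeavyLowerTailSahiMixtureMonotone
import Summits.CriticalPhenomena.PercolationContinuityZ3.Theorems.PercNearOneGluingNoHeavyLowerTailSahiMixtureHereditary
import Literature.Combinatorics.Sahi2008.FKGCumulation
import Literature.Combinatorics.Sahi2008.PushForward
import HarnessLib

/-!
# Monotone mixtures of product measures satisfy the FKG lattice condition; hence they lie in the hereditary class `𝒦_n`
# for every `n` (all intersection rows, overlapping or not)

Support file of the one-cut programme (crux `NoHeavyLowerTail`, stmt-CriticalPhenomena-4575; cell `prim-masterthm`, seat P3, gen 15;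
`run/shared/lean/prim/prim-masterthm/prim-masterthm-p3/HIERARCHY.md` §23; memo
`run/shared/lean/prim/prim-masterthm/FROM-prim-masterthm-p3-g15-MONOTONE-MIXTURES.md` §3(a)).

THE TWO FACTS.
* `isFKGMeasure_mixProdBits` — the bit-marginal `T ↦ Σ_l w_l Π_i (y_{l,i} if i ∈ T else 1 − y_{l,i})` of a monotone mixture of product measures
  (`w ≥ 0` of mass `1`, `0 ≤ y ≤ 1`, `y_{·,i}` nondecreasing in the level) is an FKG probability weight on the Boolean lattice `Finset ι`
  (log-supermodular).  This is the Karlin–Rinott composition theorem for this family; the proof here is the elementary identity behind it: for two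
  comparable product weights `P_p, P_{p'}` (`p ≤ p'`), with `u = p(1−p')`, `v = p'(1−p)` (so `u ≤ v`), `A = a∖b`, `B = b∖a`,
  `P_p(a)P_{p'}(b) + P_{p'}(a)P_p(b) = c·(u^A v^B + v^A u^B) ≤ c·(v^A v^B + u^A u^B) = P_p(a∩b)P_{p'}(a∪b) + P_{p'}(a∩b)P_p(a∪b)` since
  `(v^A − u^A)(v^B − u^B) ≥ 0`; summing over ordered pairs of levels gives the lattice condition (`prodBits_pair_le`).
* **`hereditaryAllOrders_mixProdWeight`** — consequently (Blinovsky 2014 = the tree's `sahi2008_thm2_fkg`: FKG weight + cumulation slots, every order; the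
  indicator of "all bits of `K` are on" is the cumulation `1_{T ⊇ K}`) a monotone mixture of product measures is in the HEREDITARY CLASS of the mixture
  programme: `HereditaryAllOrders (mixProdWeight w y) bitEv` — every Sahi row of the ∩-closed family generated by the bits, of every order, with
  overlapping and repeated members allowed, is `≥ 0`.  So the ladder/closure theorems of gens 6–14 stated on `𝒦_n` apply to this class, and gen 15's direct
  results (TOP/BOTTOM Bernstein at every order, every cell `≥ 0` at every order) describe a sub-class of `𝒦_n` on which the whole ladder survives.
HONEST FRAMING: nothing here asserts (M⁺-k) or `C_k` for `k ≥ 3`; general increasing events of these laws are Sahi's conjecture for an FKG measure, untouched.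
Everything PROVED, standard axioms. [this work]
-/

noncomputable section

open scoped Classical

namespace Summit.CriticalPhenomena.PercolationContinuityZ3.Theorems

open Finset Function
open Literature.Combinatorics.Sahi2008
open Literature.Probability.Percolation.DecisionTree (ind ind_of_mem ind_of_not_mem ind_nonneg)

namespace SahiMixture

section FKG

variable {ι : Type*} [Fintype ι] [DecidableEq ι]

/-- The product weight of a bit pattern `T` (as a set of "on" bits) with bit probabilities `p`. (A plain function, used through this abbreviation
only inside statements.) [folklore] -/
def prodBits (p : ι → ℝ) (T : Finset ι) : ℝ := ∏ i, (if i ∈ T then p i else 1 - p i)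

/-- Product weights are nonnegative for `p ∈ [0,1]`. [folklore] -/
theorem prodBits_nonneg {p : ι → ℝ} (h0 : ∀ i, 0 ≤ p i) (h1 : ∀ i, p i ≤ 1) (T : Finset ι) : 0 ≤ prodBits p T :=
  Finset.prod_nonneg fun i _ => by split_ifs <;> [exact h0 i; exact sub_nonneg.2 (h1 i)]

set_option linter.unnecessarySeqFocus false in
/-- **The pair inequality behind Karlin–Rinott for product weights.**  For `0 ≤ p ≤ p' ≤ 1` coordinatewise and any `a, b`:
`P_p(a)P_{p'}(b) + P_{p'}(a)P_p(b) ≤ P_p(a∩b)P_{p'}(a∪b) + P_{p'}(a∩b)P_p(a∪b)`. [this work] -/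
theorem prodBits_pair_le {p p' : ι → ℝ} (h0 : ∀ i, 0 ≤ p i) (h1 : ∀ i, p' i ≤ 1) (hle : ∀ i, p i ≤ p' i) (a b : Finset ι) :
    prodBits p a * prodBits p' b + prodBits p' a * prodBits p b
      ≤ prodBits p (a ∩ b) * prodBits p' (a ∪ b) + prodBits p' (a ∩ b) * prodBits p (a ∪ b) := by
  -- coordinates: `A = a \ b`, `B = b \ a`; `u = p(1−p')`, `v = p'(1−p)`; common factor `base` on the rest
  let u : ι → ℝ := fun i => p i * (1 - p' i)
  let v : ι → ℝ := fun i => p' i * (1 - p i)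
  let base : ι → ℝ := fun i => if i ∈ a ↔ i ∈ b then (if i ∈ a then p i else 1 - p i) * (if i ∈ a then p' i else 1 - p' i) else 1
  let UA : ℝ := ∏ i, (if i ∈ a \ b then u i else 1)
  let VA : ℝ := ∏ i, (if i ∈ a \ b then v i else 1)
  let UB : ℝ := ∏ i, (if i ∈ b \ a then u i else 1)
  let VB : ℝ := ∏ i, (if i ∈ b \ a then v i else 1)
  let C : ℝ := ∏ i, base i
  have hp1 : ∀ i, p i ≤ 1 := fun i => (hle i).trans (h1 i)
  have hp'0 : ∀ i, 0 ≤ p' i := fun i => (h0 i).trans (hle i)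
  have huv : ∀ i, 0 ≤ u i ∧ u i ≤ v i := fun i =>
    ⟨mul_nonneg (h0 i) (sub_nonneg.2 (h1 i)), by
      show p i * (1 - p' i) ≤ p' i * (1 - p i)
      nlinarith [hle i, h0 i, h1 i]⟩
  -- the four factorizations, coordinate by coordinate
  have eX : prodBits p a * prodBits p' b = C * UA * VB := by
    simp only [prodBits, C, UA, VB, ← Finset.prod_mul_distrib]
    refine Finset.prod_congr rfl fun i _ => ?_
    by_cases ha : i ∈ a <;> by_cases hb : i ∈ b <;> simp [base, u, v, ha, hb, Finset.mem_sdiff] <;> ring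
  have eX' : prodBits p' a * prodBits p b = C * VA * UB := by
    simp only [prodBits, C, VA, UB, ← Finset.prod_mul_distrib]
    refine Finset.prod_congr rfl fun i _ => ?_
    by_cases ha : i ∈ a <;> by_cases hb : i ∈ b <;> simp [base, u, v, ha, hb, Finset.mem_sdiff] <;> ring
  have eY : prodBits p (a ∩ b) * prodBits p' (a ∪ b) = C * VA * VB := by
    simp only [prodBits, C, VA, VB, ← Finset.prod_mul_distrib]
    refine Finset.prod_congr rfl fun i _ => ?_
    by_cases ha : i ∈ a <;> by_cases hb : i ∈ b <;>
      simp [base, v, ha, hb, Finset.mem_sdiff, Finset.mem_inter, Finset.mem_union] <;> ring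
  have eY' : prodBits p' (a ∩ b) * prodBits p (a ∪ b) = C * UA * UB := by
    simp only [prodBits, C, UA, UB, ← Finset.prod_mul_distrib]
    refine Finset.prod_congr rfl fun i _ => ?_
    by_cases ha : i ∈ a <;> by_cases hb : i ∈ b <;>
      simp [base, u, ha, hb, Finset.mem_sdiff, Finset.mem_inter, Finset.mem_union] <;> ring
  have hC : 0 ≤ C := Finset.prod_nonneg fun i _ => by
    simp only [base]
    split_ifs
    · exact mul_nonneg (h0 i) (hp'0 i)
    · exact mul_nonneg (sub_nonneg.2 (hp1 i)) (sub_nonneg.2 (h1 i))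
    · exact zero_le_one
  have hUA : 0 ≤ UA := Finset.prod_nonneg fun i _ => by split_ifs <;> [exact (huv i).1; exact zero_le_one]
  have hUB : 0 ≤ UB := Finset.prod_nonneg fun i _ => by split_ifs <;> [exact (huv i).1; exact zero_le_one]
  have hAle : UA ≤ VA := Finset.prod_le_prod (fun i _ => by split_ifs <;> [exact (huv i).1; exact zero_le_one])
    fun i _ => by split_ifs <;> [exact (huv i).2; exact le_rfl]
  have hBle : UB ≤ VB := Finset.prod_le_prod (fun i _ => by split_ifs <;> [exact (huv i).1; exact zero_le_one])
    fun i _ => by split_ifs <;> [exact (huv i).2; exact le_rfl]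
  rw [eX, eX', eY, eY']
  have key : 0 ≤ (VA - UA) * (VB - UB) := mul_nonneg (sub_nonneg.2 hAle) (sub_nonneg.2 hBle)
  nlinarith [mul_nonneg hC key]

variable {L : ℕ}

/-- **The bit-law of a monotone mixture of product measures is an FKG probability weight** on the Boolean lattice `Finset ι`
(log-supermodular; Karlin–Rinott for this family): `w ≥ 0` of mass `1`, `0 ≤ y ≤ 1`, `y_{·,i}` nondecreasing in the level. [this work] -/
theorem isFKGMeasure_mixProdBits (w : Fin L → ℝ) (hw0 : ∀ l, 0 ≤ w l) (hw1 : ∑ l, w l = 1)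
    (y : Fin L → ι → ℝ) (hy0 : ∀ l i, 0 ≤ y l i) (hy1 : ∀ l i, y l i ≤ 1) (hmono : ∀ i, Monotone (fun l => y l i)) :
    IsFKGMeasure (fun T : Finset ι => ∑ l, w l * prodBits (y l) T) where
  nonneg T := Finset.sum_nonneg fun l _ => mul_nonneg (hw0 l) (prodBits_nonneg (hy0 l) (hy1 l) T)
  sum_eq_one := by
    rw [Finset.sum_comm]
    have hP : ∀ l, ∑ T : Finset ι, prodBits (y l) T = 1 := by
      intro l
      -- push the bit-function sum `sum_prod_bern_pin` to `Finset ι` along `ε ↦ {i | ε i}`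
      have h := sum_prod_bern_pin (y l) (∅ : Finset ι)
      simp only [Finset.prod_empty, mul_one] at h
      rw [← h]
      refine (Finset.sum_equiv (Equiv.mk (fun T : Finset ι => fun i => decide (i ∈ T)) (fun ε => Finset.univ.filter fun i => ε i = true)
        (fun T => by ext i; simp) (fun ε => by funext i; simp)) (fun _ => by simp) (fun T _ => ?_))
      simp only [prodBits, Equiv.coe_fn_mk, Bool.cond_decide]
    simp only [← Finset.mul_sum, hP, mul_one, hw1]
  mul_le_mul a b := by
    show (∑ l, w l * prodBits (y l) a) * (∑ l, w l * prodBits (y l) b)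
        ≤ (∑ l, w l * prodBits (y l) (a ⊓ b)) * (∑ l, w l * prodBits (y l) (a ⊔ b))
    rw [Finset.inf_eq_inter, Finset.sup_eq_union, Finset.sum_mul_sum, Finset.sum_mul_sum]
    -- symmetrise over ordered pairs of levels
    have pair : ∀ l l', w l * prodBits (y l) a * (w l' * prodBits (y l') b) + w l' * prodBits (y l') a * (w l * prodBits (y l) b)
        ≤ w l * prodBits (y l) (a ∩ b) * (w l' * prodBits (y l') (a ∪ b)) + w l' * prodBits (y l') (a ∩ b) * (w l * prodBits (y l) (a ∪ b)) := by
      intro l l'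
      have hww : 0 ≤ w l * w l' := mul_nonneg (hw0 l) (hw0 l')
      rcases le_total l l' with hll | hll
      · have := prodBits_pair_le (hy0 l) (hy1 l') (fun i => hmono i hll) a b
        nlinarith [mul_le_mul_of_nonneg_left this hww]
      · have := prodBits_pair_le (hy0 l') (hy1 l) (fun i => hmono i hll) a b
        nlinarith [mul_le_mul_of_nonneg_left this hww]
    have h2 : ∀ (F : Fin L → Fin L → ℝ), 2 * ∑ l, ∑ l', F l l' = ∑ l, ∑ l', (F l l' + F l' l) := by
      intro F
      rw [two_mul]
      conv_lhs => rw [show (∑ l, ∑ l', F l l') + ∑ l, ∑ l', F l l' = (∑ l, ∑ l', F l l') + ∑ l, ∑ l', F l' l by rw [Finset.sum_comm]]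
      rw [← Finset.sum_add_distrib]
      exact Finset.sum_congr rfl fun l _ => (Finset.sum_add_distrib).symm
    have hL := h2 (fun l l' => w l * prodBits (y l) a * (w l' * prodBits (y l') b))
    have hR := h2 (fun l l' => w l * prodBits (y l) (a ∩ b) * (w l' * prodBits (y l') (a ∪ b)))
    have hsum : ∑ l, ∑ l', (w l * prodBits (y l) a * (w l' * prodBits (y l') b) + w l' * prodBits (y l') a * (w l * prodBits (y l) b))
        ≤ ∑ l, ∑ l', (w l * prodBits (y l) (a ∩ b) * (w l' * prodBits (y l') (a ∪ b))
            + w l' * prodBits (y l') (a ∩ b) * (w l * prodBits (y l) (a ∪ b))) :=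
      Finset.sum_le_sum fun l _ => Finset.sum_le_sum fun l' _ => pair l l'
    linarith

/-! ### The mixture lies in the hereditary class -/

/-- The bit-law as a push-forward: pushing `mixProdWeight w y` along `(l, ε) ↦ {i | ε i}` gives `T ↦ Σ_l w_l · prodBits (y l) T`. [this work] -/
theorem pushWeight_mixProdWeight_bits (w : Fin L → ℝ) (y : Fin L → ι → ℝ) (T : Finset ι) :
    pushWeight (mixProdWeight w y) (fun x : Fin L × (ι → Bool) => Finset.univ.filter fun i => x.2 i = true) T
      = ∑ l, w l * prodBits (y l) T := by
  rw [pushWeight_apply, Fintype.sum_prod_type]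
  refine Finset.sum_congr rfl fun l _ => ?_
  rw [Finset.sum_eq_single (fun i => decide (i ∈ T))]
  · have hT : (Finset.univ.filter fun i => (fun i => decide (i ∈ T)) i = true) = T := by ext i; simp
    rw [if_pos hT]
    simp only [mixProdWeight, prodBits, Bool.cond_decide]
  · intro ε _ hε
    rw [if_neg]
    intro h
    apply hε
    funext i
    have := congrArg (fun S : Finset ι => i ∈ S) h
    simp only [Finset.mem_filter, Finset.mem_univ, true_and, eq_iff_iff] at this
    by_cases hi : i ∈ T
    · simpa [hi] using this
    · have : ¬ (ε i = true) := fun h' => hi (this.1 h')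
      simpa [hi] using this
  · intro h; exact absurd (Finset.mem_univ _) h

/-- **A monotone mixture of product measures is in the hereditary class `𝒦_n`, for every `n`**: every Sahi row, of every order, of the ∩-closed family
generated by the bits — intersections over arbitrary (possibly overlapping, repeated) index sets — is nonnegative.  Route: the row is a row of principal
up-set indicators `1_{T ⊇ K_j}` under the bit-law, an FKG weight (`isFKGMeasure_mixProdBits`), so Blinovsky's theorem (`sahi2008_thm2_fkg`) applies.
[this work] -/
theorem hereditaryAllOrders_mixProdWeight {n : ℕ} (w : Fin L → ℝ) (hw0 : ∀ l, 0 ≤ w l) (hw1 : ∑ l, w l = 1)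
    (y : Fin L → Fin n → ℝ) (hy0 : ∀ l i, 0 ≤ y l i) (hy1 : ∀ l i, y l i ≤ 1) (hmono : ∀ i, Monotone (fun l => y l i)) :
    HereditaryAllOrders (mixProdWeight w y) (fun i : Fin n => bitEv i) := by
  intro m K
  let G : Fin L × (Fin n → Bool) → Finset (Fin n) := fun x => Finset.univ.filter fun i => x.2 i = true
  -- the members are pulled back from the principal up-set indicators `1_{T ⊇ K j}`
  have hmem : ∀ j, (ind (⋂ i ∈ K j, bitEv (L := L) i) : Fin L × (Fin n → Bool) → ℝ)
      = (fun T : Finset (Fin n) => if K j ⊆ T then (1 : ℝ) else 0) ∘ G := by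
    intro j; funext x
    simp only [Function.comp, G]
    by_cases hx : x ∈ ⋂ i ∈ K j, bitEv (L := L) i
    · rw [ind_of_mem hx, if_pos]
      intro i hi
      simp only [Finset.mem_filter, Finset.mem_univ, true_and]
      exact Set.mem_iInter₂.1 hx i hi
    · rw [ind_of_not_mem hx, if_neg]
      intro hsub
      apply hx
      refine Set.mem_iInter₂.2 fun i hi => ?_
      have := hsub hi
      simp only [Finset.mem_filter, Finset.mem_univ, true_and] at this
      exact this
  have hfam : (fun j => ind (⋂ i ∈ K j, bitEv (L := L) i)) = fun j => (fun T : Finset (Fin n) => if K j ⊆ T then (1 : ℝ) else 0) ∘ G :=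
    funext hmem
  rw [hfam, ← sahiE_pushWeight]
  have hFKG : IsFKGMeasure (pushWeight (mixProdWeight w y) G) := by
    have e : pushWeight (mixProdWeight w y) G = fun T => ∑ l, w l * prodBits (y l) T := funext (pushWeight_mixProdWeight_bits w y)
    rw [e]
    exact isFKGMeasure_mixProdBits w hw0 hw1 y hy0 hy1 hmono
  exact sahi2008_thm2_fkg _ hFKG _ fun j => isCumulation_indicator_supset (K j)

end FKG

end SahiMixture

end Summit.CriticalPhenomena.PercolationContinuityZ3.Theorems

end
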